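import Summits.Ventures.HodgeKum4.Theorems.KummerFixedLocusL1HilbEvalAux
import HarnessLib

/-!
# Lane (V), line v2p5 — stub S-E: loop-algebra evaluation is full (program induction, `E/O` induction, Vandermonde)

Cell `hodge-kum4`, crux stmt-Ventures-20141, registered stub `stub_eval` of the v2p5 skeleton.  Pure algebra over the
interface: given the certificate `LieCert` (stub S-D), the super Lie-homomorphism property of transfer operators (stub
S-A, taken as the hypothesis `hLie`), a homogeneous basis `b` of `H*(S)` in which left cup products by `b I` and the
operator `Λ` are the model matrices `mulMat I`, `lamMat`, and a subspace `W ⊆ H*(S^[n])` stable under the blocks of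
`T₁(m_{bI})` (`1 ≤ |I| ≤ 3`) and `T₋₁(Λ)`: every node of the certificate's program gives a transfer operator
`T_{tdeg}(Φ node)` stabilising `W` (induction along the program, `[T_t φ, T_{t'} ψ} = T_{t+t'}[φ,ψ}`); `[E,E] ⊇ E`,
`[E,O] ⊇ O` push `E` (`O`) to all `t`-degrees `−2i−2` (`−2i−3`); since `T_t(φ)|ₙ = −Σ_{k≤n} k^{t−1} τ_k(φ)|ₙ`, a
Vandermonde/Lagrange inversion in the nodes `k⁻²` (`…EvalAux.mem_of_vandermonde`) extracts every single-weight
`τ_k(φ)|ₙ`, and `1`, `E_{I,0} ∈ span(E∪O)` give the number operators `τ_k(id)|ₙ` and the polarisations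
`τ_k(b I ⊗ b₀^∨)|ₙ`.  V2-MECHANISM §1–§4.  Nothing here asserts L1-Hilb(n) / L1 / HC_Kum4Type / HC.
-/

noncomputable section

open DirectSum
open scoped TensorProduct
open Literature.AlgebraicTopology.SingularHomology
open Literature.AlgebraicGeometry Literature.AlgebraicGeometry.Hyperkaehler Literature.AlgebraicGeometry.HilbertScheme
open Literature.AlgebraicGeometry.Motives (ComplexPoints SchemeOver IsSmoothProjective)

namespace Summit.Ventures.HodgeKum4.L1Hilb

namespace Eval

variable {S : SchemeOver ℂ} {hS : IsSmoothProjective 2 S} {H : HilbertSchemesOfPoints S}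

/-! ### Single weights from all `t`-degrees (Vandermonde in the nodes `k⁻²`) -/

/-- The stabiliser of `W` in `End`, as a submodule. -/
def stabSub {M : Type*} [AddCommGroup M] [Module ℂ M] (W : Submodule ℂ M) : Submodule ℂ (Module.End ℂ M) where
  carrier := {R | ∀ w ∈ W, R w ∈ W}
  add_mem' {R R'} hR hR' := fun w hw ↦ by simpa only [LinearMap.add_apply] using W.add_mem (hR w hw) (hR' w hw)
  zero_mem' := fun w _ ↦ by simp
  smul_mem' c {R} hR := fun w hw ↦ by simpa only [LinearMap.smul_apply] using W.smul_mem c (hR w hw)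

/-- Membership in `stabSub`. -/
theorem mem_stabSub {M : Type*} [AddCommGroup M] [Module ℂ M] {W : Submodule ℂ M} {R : Module.End ℂ M} :
    R ∈ stabSub W ↔ ∀ w ∈ W, R w ∈ W :=
  Iff.rfl

section Weights

variable (𝔑 : NakajimaOperators hS H)
  (C : totalCohomology ℂ (ComplexPoints S) ⊗[ℂ] totalCohomology ℂ (ComplexPoints S))
  {n : ℕ} (W : Submodule ℂ (totalCohomology ℂ (ComplexPoints (H.obj n))))

/-- `zpow` bookkeeping: `k^{−2i+c} = (k²)⁻¹^i · k^c` for `k ≠ 0`. -/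
theorem zpow_split {k : ℂ} (hk : k ≠ 0) (i : ℕ) (c : ℤ) :
    k ^ (-(2 * (i : ℤ)) + c) = ((k ^ 2)⁻¹) ^ i * k ^ c := by
  rw [zpow_add₀ hk, zpow_neg, ← inv_zpow, show (2 * (i : ℤ)) = ((2 * i : ℕ) : ℤ) by push_cast; ring, zpow_natCast,
    pow_mul, inv_pow]

/-- **Vandermonde extraction.**  If the blocks `T_{−2i+c+1}(φ)|ₙ` stabilise `W` for `i = 0, …, n−1` (some fixed
integer `c`), then every single-weight `τ_k(φ)|ₙ`, `1 ≤ k ≤ n`, stabilises `W`. -/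
theorem twoPt_mem_of_degrees (φ : Module.End ℂ (totalCohomology ℂ (ComplexPoints S))) (c : ℤ)
    (h : ∀ i : ℕ, i < n → StableUnder n W (transferOp ℂ 𝔑.q C (-(2 * (i : ℤ)) + c + 1) φ))
    {k : ℕ} (hk1 : 1 ≤ k) (hkn : k ≤ n) : ∀ w ∈ W, twoPt 𝔑 C φ k n w ∈ W := by
  set 𝒲 := stabSub W with h𝒲
  -- the Vandermonde hypothesis for `v_k = k^c • τ_k(φ)|ₙ`, nodes `x_k = (k²)⁻¹`
  have hV : ∀ i : ℕ, i < (Finset.Icc 1 n).card →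
      ∑ k ∈ Finset.Icc 1 n, (((k : ℂ) ^ 2)⁻¹) ^ i • (((k : ℂ) ^ c) • twoPt 𝔑 C φ k n) ∈ 𝒲 := by
    intro i hi
    rw [Nat.card_Icc, Nat.add_sub_cancel] at hi
    have hst := (h i hi).2
    have hneg : -restrictFock ℂ (fockFamily H) (transferOp ℂ 𝔑.q C (-(2 * (i : ℤ)) + c + 1) φ) n ∈ 𝒲 :=
      𝒲.neg_mem (mem_stabSub.mpr fun w hw ↦ hst w hw)
    rw [restrictFock_transferOp, neg_neg] at hneg
    convert hneg using 1
    refine Finset.sum_congr rfl fun k hk ↦ ?_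
    have hk0 : (k : ℂ) ≠ 0 := by
      have : 1 ≤ k := (Finset.mem_Icc.mp hk).1
      exact_mod_cast (show k ≠ 0 by omega)
    rw [smul_smul, show -(2 * (i : ℤ)) + c + 1 - 1 = -(2 * (i : ℤ)) + c by ring, zpow_split hk0]
  have hinj : Set.InjOn (fun k : ℕ ↦ ((k : ℂ) ^ 2)⁻¹) (Finset.Icc 1 n) := by
    intro a ha a' ha' hab
    have hab' : ((a : ℂ) ^ 2) = ((a' : ℂ) ^ 2) := inv_injective hab
    have : ((a ^ 2 : ℕ) : ℂ) = ((a' ^ 2 : ℕ) : ℂ) := by push_cast; exact hab'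
    have h2 : a ^ 2 = a' ^ 2 := by exact_mod_cast this
    exact Nat.pow_left_injective (by norm_num) h2
  have hmem := mem_of_vandermonde 𝒲 (Finset.Icc 1 n) _ hinj _ hV (Finset.mem_Icc.mpr ⟨hk1, hkn⟩)
  -- strip the unit `k^c`
  have hk0 : (k : ℂ) ≠ 0 := by exact_mod_cast (show k ≠ 0 by omega)
  have : twoPt 𝔑 C φ k n = ((k : ℂ) ^ c)⁻¹ • (((k : ℂ) ^ c) • twoPt 𝔑 C φ k n) := by
    rw [smul_smul, inv_mul_cancel₀ (zpow_ne_zero c hk0), one_smul]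
  rw [this]
  exact mem_stabSub.mp (𝒲.smul_mem _ hmem)

end Weights

end Eval

/-! ### The stub -/

open Eval in
variable {S : SchemeOver ℂ} {hS : IsSmoothProjective 2 S} {H : HilbertSchemesOfPoints S} in
/-- (S-E) **Evaluation is full** — registered stub `stub_eval` of the v2p5 skeleton of crux stmt-Ventures-20141: the
loop algebra of `{T₁(m_{bI})}_{1≤|I|≤3} ∪ {T₋₁(Λ)}`, evaluated through the certificate `LieCert` and Vandermonde, reaches
every single-weight number operator `τ_k(id)|ₙ` and polarisation `τ_k(b I ⊗ b₀^∨)|ₙ`, `1 ≤ k ≤ n`. -/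
theorem stub_eval (hcert : LieCert) (𝔑 : NakajimaOperators hS H)
    {C : totalCohomology ℂ (ComplexPoints S) ⊗[ℂ] totalCohomology ℂ (ComplexPoints S)}
    (hCg : C ∈ evenTensorSpan ℂ (coeffFamily S)) (hC : IsCasimir ℂ (poincarePairing hS) C)
    (hLie : ∀ (t t' : ℤ) (φ ψ : Module.End ℂ (totalCohomology ℂ (ComplexPoints S))) (d d' : ℤ),
      IsOfDegree ℂ (ComplexPoints S) φ d → IsOfDegree ℂ (ComplexPoints S) ψ d' →
      superBracket ℂ (transferOp ℂ 𝔑.q C t φ) (transferOp ℂ 𝔑.q C t' ψ) d.natAbs d'.natAbs =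
        transferOp ℂ 𝔑.q C (t + t') (superBracket ℂ φ ψ d.natAbs d'.natAbs))
    (b : Module.Basis (Fin 16) ℂ (totalCohomology ℂ (ComplexPoints S)))
    (hb : ∀ I, b I ∈ LinearMap.range (ofDegree ℂ (ComplexPoints S) (deg4 I)))
    (hmul : ∀ I, Matrix.toLin b b ((mulMat I).map (Int.castRingHom ℂ)) = totalCup ℂ (ComplexPoints S) (b I))
    (Λ : Module.End ℂ (totalCohomology ℂ (ComplexPoints S)))
    (hΛ : Matrix.toLin b b (lamMat.map (Int.castRingHom ℂ)) = Λ) (n : ℕ)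
    (W : Submodule ℂ (totalCohomology ℂ (ComplexPoints (H.obj n))))
    (hgen : ∀ I : Fin 16, deg4 I ∈ ({1, 2, 3} : Set ℕ) →
      StableUnder n W (transferOp ℂ 𝔑.q C 1 (totalCup ℂ (ComplexPoints S) (b I))))
    (hf : StableUnder n W (transferOp ℂ 𝔑.q C (-1) Λ)) :
    ∀ k, 1 ≤ k → k ≤ n →
      (∀ w ∈ W, twoPt 𝔑 C LinearMap.id k n w ∈ W) ∧ ∀ I : Fin 16, I ≠ 0 → ∀ w ∈ W, twoPt 𝔑 C (polar b 0 I) k n w ∈ W := by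
  have _hEven : C ∈ evenTensorSpan ℂ (coeffFamily S) ∧ IsCasimir ℂ (poincarePairing hS) C := ⟨hCg, hC⟩
  obtain ⟨N, node, tdeg, deg, isE, isO, hprog, hhom, hE, hO, hEE, hEO, hT1, hTI⟩ := hcert
  have hdegΦ : ∀ k < N, IsOfDegree ℂ (ComplexPoints S) (Φ b (node k)) (deg k) :=
    fun k hk ↦ isOfDegree_Φ hb (hhom k hk)
  -- (E2) every program node gives a transfer operator stabilising `W`
  have hnodes : ∀ k < N, StableUnder n W (transferOp ℂ 𝔑.q C (tdeg k) (Φ b (node k))) := by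
    intro k
    induction k using Nat.strong_induction_on with
    | _ k ih =>
      intro hk
      rcases hprog k hk with ⟨I, hI, hnode, ht, -⟩ | ⟨hnode, ht, -⟩ | ⟨i, hi, j, hj, hnode, ht, -⟩
      · rw [hnode, ht, Φ_apply, hmul I]; exact hgen I hI
      · rw [hnode, ht, Φ_apply, hΛ]; exact hf
      · rw [hnode, ht, Φ_sbrMat, ← hLie _ _ _ _ _ _ (hdegΦ i (by omega)) (hdegΦ j (by omega))]
        exact StableUnder.superBracket (ih i hi (by omega)) (ih j hj (by omega)) _ _
  -- (E3) a combination step: from `L • node m = Σ c • [node a, node b']` with `T_{-2}(Φ a)`, `T_{s}(Φ b')` stabilising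
  have step : ∀ (s : ℤ) (m : ℕ) (L : ℤ) (terms : List (ℕ × ℕ × ℤ)), L ≠ 0 →
      (∀ t ∈ terms, t.1 < N ∧ t.2.1 < N ∧ StableUnder n W (transferOp ℂ 𝔑.q C (-2) (Φ b (node t.1))) ∧
        StableUnder n W (transferOp ℂ 𝔑.q C s (Φ b (node t.2.1)))) →
      L • node m = (terms.map fun t ↦ t.2.2 • sbrMat (node t.1) (deg t.1) (node t.2.1) (deg t.2.1)).sum →
      StableUnder n W (transferOp ℂ 𝔑.q C (-2 + s) (Φ b (node m))) := by
    intro s m L terms hL0 hterms hid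
    have hL : StableUnder n W ((L : ℂ) • transferOp ℂ 𝔑.q C (-2 + s) (Φ b (node m))) := by
      rw [← transferOp_smul, ← Φ_zsmul, hid, map_list_sum, List.map_map]
      have : (terms.map (⇑(Φ b) ∘ fun t ↦ t.2.2 • sbrMat (node t.1) (deg t.1) (node t.2.1) (deg t.2.1))) =
          terms.map fun t ↦ (t.2.2 : ℂ) • superBracket ℂ (Φ b (node t.1)) (Φ b (node t.2.1)) (deg t.1).natAbs
            (deg t.2.1).natAbs := by
        refine List.map_congr_left fun t _ ↦ ?_
        simp only [Function.comp_apply, Φ_zsmul, Φ_sbrMat]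
      rw [this, transferOp_list_sum]
      refine StableUnder.list_sum _ _ fun t ht ↦ StableUnder.smul _ ?_
      obtain ⟨ha, hb', hSa, hSb⟩ := hterms t ht
      rw [← hLie _ _ _ _ _ _ (hdegΦ _ ha) (hdegΦ _ hb')]
      exact StableUnder.superBracket hSa hSb _ _
    have : transferOp ℂ 𝔑.q C (-2 + s) (Φ b (node m)) =
        (L : ℂ)⁻¹ • ((L : ℂ) • transferOp ℂ 𝔑.q C (-2 + s) (Φ b (node m))) := by
      rw [smul_smul, inv_mul_cancel₀ (by exact_mod_cast hL0), one_smul]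
    rw [this]
    exact StableUnder.smul _ hL
  -- `E` in all degrees `−2i−2` (written `−2i + (−3) + 1`), `O` in all degrees `−2i−3` (written `−2i + (−4) + 1`)
  have hEbase : ∀ a, isE a = true → StableUnder n W (transferOp ℂ 𝔑.q C (-2) (Φ b (node a))) := by
    intro a ha
    have h := hnodes a (hE a ha).1
    rwa [(hE a ha).2] at h
  have hEdeg : ∀ i : ℕ, ∀ m, isE m = true →
      StableUnder n W (transferOp ℂ 𝔑.q C (-(2 * (i : ℤ)) + (-3) + 1) (Φ b (node m))) := by
    intro i
    induction i with
    | zero =>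
      intro m hm
      have hs : (-(2 * ((0 : ℕ) : ℤ)) + (-3) + 1) = -2 := by norm_num
      rw [hs]
      exact hEbase m hm
    | succ i ih =>
      intro m hm
      obtain ⟨L, terms, hL0, hmem, hid⟩ := hEE m hm
      have hs : (-(2 * ((i + 1 : ℕ) : ℤ)) + (-3) + 1) = -2 + (-(2 * (i : ℤ)) + (-3) + 1) := by push_cast; ring
      rw [hs]
      exact step _ m L terms hL0 (fun t ht ↦ ⟨(hE _ (hmem t ht).1).1, (hE _ (hmem t ht).2).1,
        hEbase _ (hmem t ht).1, ih _ (hmem t ht).2⟩) hid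
  have hOdeg : ∀ i : ℕ, ∀ m, isO m = true →
      StableUnder n W (transferOp ℂ 𝔑.q C (-(2 * (i : ℤ)) + (-4) + 1) (Φ b (node m))) := by
    intro i
    induction i with
    | zero =>
      intro m hm
      have h := hnodes m (hO m hm).1
      have hs : (-(2 * ((0 : ℕ) : ℤ)) + (-4) + 1) = -3 := by norm_num
      rw [(hO m hm).2] at h
      rwa [hs]
    | succ i ih =>
      intro m hm
      obtain ⟨L, terms, hL0, hmem, hid⟩ := hEO m hm
      have hs : (-(2 * ((i + 1 : ℕ) : ℤ)) + (-4) + 1) = -2 + (-(2 * (i : ℤ)) + (-4) + 1) := by push_cast; ring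
      rw [hs]
      exact step _ m L terms hL0 (fun t ht ↦ ⟨(hE _ (hmem t ht).1).1, (hO _ (hmem t ht).2).1,
        hEbase _ (hmem t ht).1, ih _ (hmem t ht).2⟩) hid
  -- (E4) single weights for every node of `E ∪ O`
  intro k hk1 hkn
  have hEO4 : ∀ m, (isE m = true ∨ isO m = true) → ∀ w ∈ W, twoPt 𝔑 C (Φ b (node m)) k n w ∈ W := by
    rintro m (hm | hm)
    · exact twoPt_mem_of_degrees 𝔑 C W _ (-3) (fun i _ ↦ hEdeg i m hm) hk1 hkn
    · exact twoPt_mem_of_degrees 𝔑 C W _ (-4) (fun i _ ↦ hOdeg i m hm) hk1 hkn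
  -- (E5) targets by linearity
  set 𝒲 := stabSub W with h𝒲
  have htarget : ∀ (L : ℤ) (terms : List (ℕ × ℤ)), L ≠ 0 → (∀ t ∈ terms, isE t.1 = true ∨ isO t.1 = true) →
      ∀ M : Matrix (Fin 16) (Fin 16) ℤ, L • M = (terms.map fun t ↦ t.2 • node t.1).sum →
      ∀ w ∈ W, twoPt 𝔑 C (Φ b M) k n w ∈ W := by
    intro L terms hL0 hmem M hid
    have hL : (L : ℂ) • twoPt 𝔑 C (Φ b M) k n ∈ 𝒲 := by
      rw [← twoPt_smul, ← Φ_zsmul, hid, map_list_sum, List.map_map]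
      have : (terms.map (⇑(Φ b) ∘ fun t ↦ t.2 • node t.1)) = terms.map fun t ↦ (t.2 : ℂ) • Φ b (node t.1) := by
        refine List.map_congr_left fun t _ ↦ ?_
        simp only [Function.comp_apply, Φ_zsmul]
      rw [this, twoPt_list_sum]
      refine 𝒲.list_sum_mem fun x hx ↦ ?_
      obtain ⟨t, ht, rfl⟩ := List.mem_map.mp hx
      exact 𝒲.smul_mem _ (mem_stabSub.mpr (hEO4 t.1 (hmem t ht)))
    have : twoPt 𝔑 C (Φ b M) k n = (L : ℂ)⁻¹ • ((L : ℂ) • twoPt 𝔑 C (Φ b M) k n) := by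
      rw [smul_smul, inv_mul_cancel₀ (by exact_mod_cast hL0), one_smul]
    rw [this]
    exact mem_stabSub.mp (𝒲.smul_mem _ hL)
  refine ⟨?_, fun I hI ↦ ?_⟩
  · obtain ⟨L, terms, hL0, hmem, hid⟩ := hT1
    have h := htarget L terms hL0 hmem 1 hid
    rwa [map_one] at h
  · obtain ⟨L, terms, hL0, hmem, hid⟩ := hTI I hI
    have h := htarget L terms hL0 hmem _ hid
    rwa [Φ_single] at h

end Summit.Ventures.HodgeKum4.L1Hilb

end
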